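import Summits.FinalStateConjecture.FinalStateConjecture.Theorems.PhotonSphereChannelsChannelsResolveTameDevelopmentsRKerrDevPush
import Summits.FinalStateConjecture.FinalStateConjecture.Theorems.PhotonSphereChannelsChannelsResolveTameDevelopmentsRKerrDevBasics
import Literature.Geometry.Lorentzian.SpacetimeLocalConvergenceChartOrientation
import Literature.Geometry.Lorentzian.BackgroundChartCalculus
import HarnessLib

/-!
# Route PhotonSphereChannels · crux `ChannelsResolveTameDevelopmentsR` (K2R, stmt-FinalStateConjecture-14075) — the
# one-sided deviation DICTIONARY of stub S1 `stub_silentHullExtraction` for EXTENDABLE anchored window charts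
# (line `kerr-isolation-dichotomy`, lead c2; stub-worker S1; registered sub-goals `stub_silentHullDictionary_extendable`,
# `eventually_isWindowChart_embed_comp`, `kerrDevDictionary_of_extendable`)

Clause (3) of S1 — `kerrDev 𝓢 p R < ε ⇒ ∀ᶠ n, kerrDev 𝒟 (q (φ n)) R < ε` along a pointed `C²_loc` limit
`(𝒟, q (φ n)) ⇀ (𝓢, p)` — is obtained by PUSHING one near-optimal anchored window chart `Ψ` of the limit through the
comparison maps `φₙ = Dat.embed n` of the convergence datum. This file proves the honest, provable form of that
move, for charts which are EXTENDABLE across the closed window and carry a TIMELIKE MARGIN where the orientation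
clause of `IsWindowChart` is tested:

* `eventually_isWindowChart_embed_comp'` — **admissibility half.** If `Ψ` agrees on the window
  `W = B_R(x₀) ∩ {r > r₊}` with a map `Ψ'` that is `C^∞` on an open `O ⊇ closure W`, and `dΨ'(∂_{t*})` is timelike
  and future-directed on `closure W ∩ {r ≥ 2M}`, then for all large `n` the pushed chart `φₙ ∘ Ψ` is again an
  anchored window chart, at the base point `pₙ (Dat.sub n)`: anchor by `embed_basepoint`; smooth and injective on `W`
  because the compact `Ψ'(closure W)` eventually lies in `Dat.U n` (`eventually_subset_U`), where `φₙ` is a smooth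
  injection; orientation by the Literature chart-orientation theorem
  `LocalSubconvergence.eventually_isFutureDirected_mfderiv_comp_chart` on the COMPACT set `closure W ∩ {r ≥ 2M}`
  (continuity of `Kerr.radius`), transported to `Ψ` by the germ identity `dΨ_x = dΨ'_x` on the open window
  (`mfderiv_comp_eq_of_eqOn_kerrWindow`).
* `stub_silentHullDictionary_extendable` — **the dictionary.** With admissible parameters `0 ≤ M`, `|a| ≤ M` and
  window `C²`-deviation `< ε`, eventually `kerrDev (𝓢ₙ (Dat.sub n)) (pₙ (Dat.sub n)) R < ε`: the admissibility half
  plus the deviation half `eventually_supCkENorm_deviationExtend_embed_comp_lt` of `…RKerrDevPush.lean` plus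
  `kerrDev_lt_of_isWindowChart`. `eventually_isWindowChart_embed_comp` / `kerrDevDictionary_of_extendable` are the
  forms registered by lead #2 (one redundant hypothesis, invertibility of `dΨ'`, kept verbatim and unused).
* `stub_silentHullDictionary_hull` — the same along a hull datum of a development (constant family
  `(𝒟, q (Dat.sub n)) ⇀ (𝓢, p)`), the shape consumed by `isoWindow` once the extraction absorbs `Dat.sub`
  (`…RHullSubsequences.lean`).
* `eventually_isFutureDirected_mfderiv_embed_comp_singleton` — orientation at ONE point (the anchor) survives the
  push as soon as the vector is timelike there: the lemma an ANCHOR-ONLY orientation clause would need (Reshape note).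

WHY THE TWO EXTRA HYPOTHESES ARE NOT REMOVABLE (audit for the lead; numbers in the evidence file
`work/stubs/stub_silentHullExtraction_missing.lean`). (E) Extendability: `SubconvergesLocallyTo` controls
`φₙ^* gₙ − g` only on compact subsets of the limit, and the closed window `closure W` leaves the exterior wherever it
meets the horizon `{r = r₊}`, the sphere `∂B_R(x₀)` or (for `M = a = 0`) the axis; scale loss `R' < R` removes only
the sphere. (T) Timelike margin: `IsWindowChart.future` is a CLOSED pointwise condition (`dΨ(∂_{t*})` causal and
`g(T, ·) < 0` on `W ∩ {r > 2M}`); a `g`-null vector is tipped spacelike by a generic `C²`-small change of metric, so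
without a margin the pushed chart fails the clause in the shell `{2M < r < 2M + o(1)}` — and for `M > 0` even EXACT
Kerr charts have `∂_{t*}` null on `closure W ∩ {r = 2M, 2H = 1}` (for `a = 0` the whole horizon sphere, for
`a ≠ 0` the equatorial circle), so (T) excludes closed windows meeting that set. For `M = 0` (flat model) (T) is
automatic for `C⁰`-pinched representatives (`Spacetime.isTimelike_mfderiv_basisVector_zero_of_norm_metricInCoords_sub_lt_one`).

References: Petersen 2006, Ch. 10 §3.2 (pointed convergence, pushing charts through comparison maps)
[Petersen2006]; O'Neill 1983, Ch. 5, p. 145 (timecones) [ONeill1983]; the `Cᵏ` window deviation is modelled on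
DHRT arXiv:2104.08222 §1 [arXiv210408222].
-/

noncomputable section

-- the operator-norm instance on `E4 →L[ℝ] E4 →L[ℝ] ℝ` needs one more level of pending
-- instance problems than the default (as in `PhotonSphereChannelsKerrDevDefs.lean`)
set_option maxSynthPendingDepth 3
-- every `Summit.FinalStateConjecture.FinalStateConjecture.…` name repeats the summit = sub-problem segment (D-0017 layout)
set_option linter.dupNamespace false

open Set Filter Function TopologicalSpace Manifold Bundle
open scoped Topology Manifold ContDiff ENNReal NNReal

namespace Summit.FinalStateConjecture.FinalStateConjecture.Theorems

open Literature.Geometry.Lorentzian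
open Summit.FinalStateConjecture.FinalStateConjecture.Theorems.TameHull

/-! ### Germs: the differential of a chart on the open window is that of its representative -/

section Germ

variable {𝓢 𝓣 : Spacetime.{0} 4}

/-- **The differential on the window is that of the representative.** If `Ψ = Ψ' ∘ val` on the (open) window and
`F ∘ Ψ'` is differentiable at a window point `x`, then `d(F ∘ Ψ)_x = d(F ∘ Ψ')_{↑x}` (`F = id`: the chart itself;
`F = Dat.embed n`: the pushed chart). Germ invariance of `mfderiv` and `d(Subtype.val) = id`. [folklore] -/
theorem mfderiv_comp_eq_of_eqOn_kerrWindow {M a R : ℝ} {x₀ : Kerr.exterior M a}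
    {Ψ : Kerr.exterior M a → 𝓢.carrier} {Ψ' : E4 → 𝓢.carrier} (F : 𝓢.carrier → 𝓣.carrier)
    (hΨ : ∀ x ∈ kerrWindow M a x₀ R, Ψ x = Ψ' x.1) {x : Kerr.exterior M a}
    (hx : x ∈ kerrWindow M a x₀ R) (hd : MDifferentiableAt 𝓘(ℝ, E4) (𝓡 4) (F ∘ Ψ') x.1) :
    mfderiv 𝓘(ℝ, E4) (𝓡 4) (F ∘ Ψ) x = mfderiv 𝓘(ℝ, E4) (𝓡 4) (F ∘ Ψ') x.1 := by
  have hgerm : (F ∘ Ψ) =ᶠ[𝓝 x] ((F ∘ Ψ') ∘ (Subtype.val : Kerr.exterior M a → E4)) := by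
    filter_upwards [(isOpen_kerrWindow M a x₀ R).mem_nhds hx] with w hw
    show F (Ψ w) = F (Ψ' w.1)
    rw [hΨ w hw]
  rw [hgerm.mfderiv_eq]
  exact 𝓣.mfderiv_comp_subtypeVal_opens (U := Kerr.exterior M a) x hd

/-- Future-directedness of a coordinate vector read at two (equal) base points (the tangent spaces of a spacetime
are all the model space `E4`, so only the base point has to be transported). [folklore] -/
theorem isFutureDirected_iff_of_eq {x y : 𝓣.carrier} (h : x = y) {v : E4} :
    𝓣.timeOrientation.IsFutureDirected (x := x) v ↔ 𝓣.timeOrientation.IsFutureDirected (x := y) v := by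
  subst h
  exact Iff.rfl

end Germ

/-! ### Pushing an extendable anchored window chart through a pointed limit -/

section Push

variable {𝓢ₙ : ℕ → Spacetime.{0} 4} {pₙ : ∀ n, (𝓢ₙ n).carrier} {𝓢 : Spacetime.{0} 4} {p : 𝓢.carrier}
  {k : ℕ}

/-- **Orientation at one point survives the push when the vector is timelike there.** For `Ψ'` smooth on an open
`O ∋ y` and a coordinate vector `V` with `dΨ'_y(V)` timelike and future-directed, for all large `n` the pushed map
`Dat.embed n ∘ Ψ'` sends `V` at `y` to a future-directed vector (the Literature chart-orientation theorem on the
compact set `{y}`). This is exactly what an ANCHOR-ONLY orientation clause needs; a merely causal (null) image can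
be tipped spacelike by every comparison map. [cite: ONeill1983, Ch. 5, p. 145] -/
theorem eventually_isFutureDirected_mfderiv_embed_comp_singleton (Dat : Spacetime.LocalSubconvergence 𝓢ₙ pₙ 𝓢 p k)
    {Ψ' : E4 → 𝓢.carrier} {O : Set E4} (hO : IsOpen O) (hΨ' : ContMDiffOn 𝓘(ℝ, E4) (𝓡 4) ∞ Ψ' O) {y : E4}
    (hy : y ∈ O) (V : E4) (htl : 𝓢.metric.IsTimelike (mfderiv 𝓘(ℝ, E4) (𝓡 4) Ψ' y V))
    (hfut : 𝓢.timeOrientation.IsFutureDirected (mfderiv 𝓘(ℝ, E4) (𝓡 4) Ψ' y V)) :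
    ∀ᶠ n in atTop, (𝓢ₙ (Dat.sub n)).timeOrientation.IsFutureDirected
      (mfderiv 𝓘(ℝ, E4) (𝓡 4) (Dat.embed n ∘ Ψ') y V) := by
  have h := Dat.eventually_isFutureDirected_mfderiv_comp_chart hO hΨ' isCompact_singleton
    (singleton_subset_iff.2 hy) V (fun x hx ↦ by rw [mem_singleton_iff.1 hx]; exact hfut)
    fun x hx ↦ by rw [mem_singleton_iff.1 hx]; exact htl
  exact h.mono fun n hn ↦ hn y (mem_singleton y)

/-- **Admissibility half of the dictionary (pushed extendable charts are anchored window charts).** Let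
`Dat : (𝓢ₙ, pₙ) ⇀ (𝓢, p)` be a pointed `Cᵏ_loc` datum, `Ψ` an anchored window chart at `p` (parameters `(M, a)`,
anchor `x₀`, scale `R`) which agrees on the window `W` with a map `Ψ'` of class `C^∞` on an open `O ⊇ closure W`,
such that `dΨ'(∂_{t*})` is TIMELIKE and future-directed at every point of `closure W ∩ {r ≥ 2M}`. Then for all
large `n`, `Dat.embed n ∘ Ψ` is an anchored window chart at `pₙ (Dat.sub n)` (same parameters, anchor, scale):
anchor by `embed_basepoint`, smoothness and injectivity on `W` from those of `Dat.embed n` on `Dat.U n ⊇ Ψ'(closure W)`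
(eventually, `eventually_subset_U`), orientation by `eventually_isFutureDirected_mfderiv_comp_chart` on the compact
`closure W ∩ {r ≥ 2M}`. [cite: Petersen2006, Ch. 10 §3.2] -/
theorem eventually_isWindowChart_embed_comp' (Dat : Spacetime.LocalSubconvergence 𝓢ₙ pₙ 𝓢 p k) {M a R : ℝ}
    {x₀ : Kerr.exterior M a} {Ψ : Kerr.exterior M a → 𝓢.carrier} {O : Set E4} {Ψ' : E4 → 𝓢.carrier}
    (hO : IsOpen O) (hKO : closure (Subtype.val '' kerrWindow M a x₀ R) ⊆ O)
    (hΨ' : ContMDiffOn 𝓘(ℝ, E4) (𝓡 4) ∞ Ψ' O) (hΨ : ∀ x ∈ kerrWindow M a x₀ R, Ψ x = Ψ' x.1)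
    (hW : IsWindowChart 𝓢 M a x₀ R p Ψ)
    (hτ : ∀ y ∈ closure (Subtype.val '' kerrWindow M a x₀ R), 2 * M ≤ Kerr.radius a y →
      𝓢.metric.IsTimelike (mfderiv 𝓘(ℝ, E4) (𝓡 4) Ψ' y (E4.basisVector 0)) ∧
        𝓢.timeOrientation.IsFutureDirected (mfderiv 𝓘(ℝ, E4) (𝓡 4) Ψ' y (E4.basisVector 0))) :
    ∀ᶠ n in atTop, IsWindowChart (𝓢ₙ (Dat.sub n)) M a x₀ R (pₙ (Dat.sub n)) (Dat.embed n ∘ Ψ) := by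
  set S : Set E4 := Subtype.val '' kerrWindow M a x₀ R with hS
  set K : Set E4 := closure S with hK
  -- the closed window is compact and lies in `O`
  have hSball : S ⊆ Metric.ball (x₀ : E4) R := by
    rintro _ ⟨x, hx, rfl⟩
    exact hx
  have hKc : IsCompact K :=
    (isCompact_closedBall (x₀ : E4) R).of_isClosed_subset isClosed_closure
      (closure_minimal (hSball.trans Metric.ball_subset_closedBall) Metric.isClosed_closedBall)
  have hSO : S ⊆ O := subset_closure.trans hKO
  -- its part outside `{r < 2M}` is compact too
  set K₂ : Set E4 := K ∩ {y | 2 * M ≤ Kerr.radius a y} with hK₂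
  have hK₂c : IsCompact K₂ := hKc.inter_right (isClosed_le continuous_const (Kerr.continuous_radius a))
  have hK₂O : K₂ ⊆ O := inter_subset_left.trans hKO
  -- the image of the closed window eventually lies in `U n`
  have hC : IsCompact (Ψ' '' K) := hKc.image_of_continuousOn (hΨ'.continuousOn.mono hKO)
  have hKU : ∀ᶠ n in atTop, Ψ' '' K ⊆ Dat.U n := Dat.eventually_subset_U hC
  -- the orientation clause on `K₂`, for the representative
  have hor : ∀ᶠ n in atTop, ∀ y ∈ K₂, (𝓢ₙ (Dat.sub n)).timeOrientation.IsFutureDirected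
      (mfderiv 𝓘(ℝ, E4) (𝓡 4) (Dat.embed n ∘ Ψ') y (E4.basisVector 0)) :=
    Dat.eventually_isFutureDirected_mfderiv_comp_chart hO hΨ' hK₂c hK₂O (E4.basisVector 0)
      (fun y hy ↦ (hτ y hy.1 hy.2).2) fun y hy ↦ (hτ y hy.1 hy.2).1
  filter_upwards [hKU, hor] with n hKn hn
  -- window points are mapped by `Ψ = Ψ'` into `U n`
  have hmaps : MapsTo Ψ (kerrWindow M a x₀ R) (Dat.U n : Set 𝓢.carrier) := fun x hx ↦ by
    rw [hΨ x hx]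
    exact hKn ⟨x.1, subset_closure ⟨x, hx, rfl⟩, rfl⟩
  have hVo : IsOpen (O ∩ Ψ' ⁻¹' (Dat.U n : Set 𝓢.carrier)) :=
    hΨ'.continuousOn.isOpen_inter_preimage hO (Dat.U n).isOpen
  have hEd : ∀ z ∈ O ∩ Ψ' ⁻¹' (Dat.U n : Set 𝓢.carrier),
      MDifferentiableAt 𝓘(ℝ, E4) (𝓡 4) (Dat.embed n ∘ Ψ') z := fun z hz ↦ by
    have h1 : MDifferentiableAt (𝓡 4) (𝓡 4) (Dat.embed n) (Ψ' z) :=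
      ((Dat.contMDiffOn_embed n _ hz.2).contMDiffAt ((Dat.U n).isOpen.mem_nhds hz.2)).mdifferentiableAt
        (by simp)
    exact h1.comp z (((hΨ' z hz.1).contMDiffAt (hO.mem_nhds hz.1)).mdifferentiableAt (by simp))
  refine ⟨?_, ?_, ?_, fun x hx hr ↦ ?_⟩
  · -- anchor
    show Dat.embed n (Ψ x₀) = pₙ (Dat.sub n)
    rw [hW.anchor, Dat.embed_basepoint]
  · -- smooth on the window
    exact (Dat.contMDiffOn_embed n).comp hW.contMDiffOn hmaps
  · -- injective on the window
    exact (Dat.injOn_embed n).comp hW.injOn hmaps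
  · -- `∂_{t*}` future-directed on the window outside `{r ≤ 2M}`
    have hxS : x.1 ∈ S := ⟨x, hx, rfl⟩
    have hxK₂ : x.1 ∈ K₂ := ⟨subset_closure hxS, hr.le⟩
    have hxU : x.1 ∈ O ∩ Ψ' ⁻¹' (Dat.U n : Set 𝓢.carrier) := ⟨hSO hxS, hKn ⟨x.1, subset_closure hxS, rfl⟩⟩
    have hpt : (Dat.embed n ∘ Ψ) x = (Dat.embed n ∘ Ψ') x.1 := by
      show Dat.embed n (Ψ x) = Dat.embed n (Ψ' x.1)
      rw [hΨ x hx]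
    rw [mfderiv_comp_eq_of_eqOn_kerrWindow (Dat.embed n) hΨ hx (hEd _ hxU)]
    exact (isFutureDirected_iff_of_eq hpt).2 (hn x.1 hxK₂)

/-- **Registered sub-goal `stub_silentHullDictionary_extendable` — the one-sided deviation dictionary for EXTENDABLE
anchored window charts (clause (3) of `stub_silentHullExtraction` in its provable form).** Let
`Dat : (𝓢ₙ, pₙ) ⇀ (𝓢, p)` be a pointed `C²_loc` subconvergence datum and `Ψ` an anchored window chart at `p` with
admissible parameters `0 ≤ M`, `|a| ≤ M`, anchor `x₀`, scale `R`, which on the window `W = B_R(x₀) ∩ {r > r₊}` is the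
restriction of a map `Ψ'` of class `C^∞` on an open `O ⊇ closure W` with `dΨ'(∂_{t*})` timelike and future-directed
on `closure W ∩ {r ≥ 2M}`. If the window `C²`-deviation of `Ψ` is `< ε`, then for all large `n`
`kerrDev (𝓢ₙ (Dat.sub n)) (pₙ (Dat.sub n)) R < ε`: the pushed chart `Dat.embed n ∘ Ψ` is eventually admissible
(`eventually_isWindowChart_embed_comp'`) with window `C²`-deviation eventually `< ε`
(`eventually_supCkENorm_deviationExtend_embed_comp_lt`, Petersen 2006 Ch. 10 §3.2 transport on the compact closed
window), and one admissible chart bounds the infimum (`kerrDev_lt_of_isWindowChart`). [cite: Petersen2006, Ch. 10 §3.2] -/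
theorem stub_silentHullDictionary_extendable : ∀ {𝓢ₙ : ℕ → Spacetime.{0} 4} {pₙ : ∀ n, (𝓢ₙ n).carrier} {𝓢 : Spacetime.{0} 4} {p : 𝓢.carrier} (Dat : Spacetime.LocalSubconvergence 𝓢ₙ pₙ 𝓢 p 2) {M a R : ℝ} {x₀ : Kerr.exterior M a} {Ψ : Kerr.exterior M a → 𝓢.carrier} {O : Set E4} {Ψ' : E4 → 𝓢.carrier} {ε : ℝ≥0∞}, 0 ≤ M → |a| ≤ M → IsOpen O → closure (Subtype.val '' kerrWindow M a x₀ R) ⊆ O → ContMDiffOn 𝓘(ℝ, E4) (𝓡 4) ∞ Ψ' O → (∀ x ∈ kerrWindow M a x₀ R, Ψ x = Ψ' x.1) → IsWindowChart 𝓢 M a x₀ R p Ψ → (∀ y ∈ closure (Subtype.val '' kerrWindow M a x₀ R), 2 * M ≤ Kerr.radius a y → 𝓢.metric.IsTimelike (mfderiv 𝓘(ℝ, E4) (𝓡 4) Ψ' y (E4.basisVector 0)) ∧ 𝓢.timeOrientation.IsFutureDirected (mfderiv 𝓘(ℝ, E4) (𝓡 4) Ψ' y (E4.basisVector 0))) →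 supCkENorm (Subtype.val '' kerrWindow M a x₀ R) 2 (𝓢.deviationExtend (Kerr.background M a) Ψ) < ε → ∀ᶠ n in atTop, kerrDev (𝓢ₙ (Dat.sub n)) (pₙ (Dat.sub n)) R < ε := by
  intro 𝓢ₙ pₙ 𝓢 p Dat M a R x₀ Ψ O Ψ' ε hM ha hO hKO hΨ' hΨ hW hτ hdev
  filter_upwards [eventually_isWindowChart_embed_comp' Dat hO hKO hΨ' hΨ hW hτ,
    eventually_supCkENorm_deviationExtend_embed_comp_lt Dat hO hKO hΨ' hΨ hdev] with n hWn hdevn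
  exact kerrDev_lt_of_isWindowChart hM ha hWn hdevn

/-- **Registered sub-goal `eventually_isWindowChart_embed_comp`** (the admissibility half in the form registered by
lead #2 prover-line-stmt-FinalStateConjecture-14075-1, 12:42Z; its invertibility hypothesis on `dΨ'` is redundant and
unused): pushed extendable anchored window charts with a timelike margin are eventually anchored window charts.
[cite: Petersen2006, Ch. 10 §3.2] -/
theorem eventually_isWindowChart_embed_comp : ∀ {𝓢ₙ : ℕ → Spacetime.{0} 4} {pₙ : ∀ n, (𝓢ₙ n).carrier} {𝓢 : Spacetime.{0} 4} {p : 𝓢.carrier} {k : ℕ} (Dat : Spacetime.LocalSubconvergence 𝓢ₙ pₙ 𝓢 p k) {M a R : ℝ} {x₀ : Kerr.exterior M a} {Ψ : Kerr.exterior M a → 𝓢.carrier} {O : Set E4} {Ψ' : E4 → 𝓢.carrier}, IsOpen O → closure (Subtype.val '' kerrWindow M a x₀ R) ⊆ O → ContMDiffOn 𝓘(ℝ, E4) (𝓡 4) ∞ Ψ' O → (∀ y ∈ O, (mfderiv 𝓘(ℝ, E4) (𝓡 4) Ψ' y).IsInvertible) → (∀ x ∈ kerrWindow M a x₀ R, Ψ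 x = Ψ' x.1) → IsWindowChart 𝓢 M a x₀ R p Ψ → (∀ y ∈ closure (Subtype.val '' kerrWindow M a x₀ R), 2 * M ≤ Kerr.radius a y → 𝓢.metric.IsTimelike (mfderiv 𝓘(ℝ, E4) (𝓡 4) Ψ' y (E4.basisVector 0)) ∧ 𝓢.timeOrientation.IsFutureDirected (mfderiv 𝓘(ℝ, E4) (𝓡 4) Ψ' y (E4.basisVector 0))) → ∀ᶠ n in atTop, IsWindowChart (𝓢ₙ (Dat.sub n)) M a x₀ R (pₙ (Dat.sub n)) (Dat.embed n ∘ Ψ) :=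
  fun Dat _ _ _ _ _ _ _ hO hKO hΨ' _hinv hΨ hW hτ ↦ eventually_isWindowChart_embed_comp' Dat hO hKO hΨ' hΨ hW hτ

/-- **Registered sub-goal `kerrDevDictionary_of_extendable`** (the dictionary in the form registered by lead #2
prover-line-stmt-FinalStateConjecture-14075-1, 12:43Z; redundant invertibility hypothesis kept and unused).
[cite: Petersen2006, Ch. 10 §3.2] -/
theorem kerrDevDictionary_of_extendable : ∀ {𝓢ₙ : ℕ → Spacetime.{0} 4} {pₙ : ∀ n, (𝓢ₙ n).carrier} {𝓢 : Spacetime.{0} 4} {p : 𝓢.carrier} (Dat : Spacetime.LocalSubconvergence 𝓢ₙ pₙ 𝓢 p 2) {M a R : ℝ} {x₀ : Kerr.exterior M a} {Ψ : Kerr.exterior M a → 𝓢.carrier} {O : Set E4} {Ψ' : E4 → 𝓢.carrier} {ε : ℝ≥0∞}, 0 ≤ M → |a| ≤ M → IsOpen O → closure (Subtype.val '' kerrWindow M a x₀ R) ⊆ O → ContMDiffOn 𝓘(ℝ, E4) (𝓡 4) ∞ Ψ' O → (∀ y ∈ O, (mfderiv 𝓘(ℝ, E4) (𝓡 4) Ψ'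 y).IsInvertible) → (∀ x ∈ kerrWindow M a x₀ R, Ψ x = Ψ' x.1) → IsWindowChart 𝓢 M a x₀ R p Ψ → (∀ y ∈ closure (Subtype.val '' kerrWindow M a x₀ R), 2 * M ≤ Kerr.radius a y → 𝓢.metric.IsTimelike (mfderiv 𝓘(ℝ, E4) (𝓡 4) Ψ' y (E4.basisVector 0)) ∧ 𝓢.timeOrientation.IsFutureDirected (mfderiv 𝓘(ℝ, E4) (𝓡 4) Ψ' y (E4.basisVector 0))) → supCkENorm (Subtype.val '' kerrWindow M a x₀ R) 2 (𝓢.deviationExtend (Kerr.background M a) Ψ) < ε → ∀ᶠ n in atTop, kerrDev (𝓢ₙ (Dat.sub n)) (pₙ (Dat.sub n)) R < ε :=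
  fun Dat _ _ _ _ _ _ _ _ hM ha hO hKO hΨ' _hinv hΨ hW hτ hdev ↦
    stub_silentHullDictionary_extendable Dat hM ha hO hKO hΨ' hΨ hW hτ hdev

end Push

/-! ### Along a hull datum of a development -/

section Hull

variable {X : Type} [TopologicalSpace X] [ChartedSpace E3 X] [IsManifold (𝓡 3) ∞ X]
  [T2Space X] [SecondCountableTopology X] [ConnectedSpace X] {D : InitialDataSet (𝓡 3) X}

omit [T2Space X] [SecondCountableTopology X] in
/-- **The dictionary along a hull datum.** For a development `𝒟`, a sequence `q` and a pointed `C²_loc` datum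
`Dat : (𝒟, q n) ⇀ (𝓢, p)` (e.g. from `IsHullElement.subconverges`), an extendable anchored window chart at `p` with a
timelike margin and window `C²`-deviation `< ε` forces `kerrDev 𝒟 (q (Dat.sub n)) R < ε` for all large `n` — clause
(3) of S1 along the datum's own subsequence, which the extraction of S1 absorbs
(`isHullElement_exists_extraction`, `nonempty_localSubconvergence_comp_sub`). [cite: Anderson2004, Def. 1.1] -/
theorem stub_silentHullDictionary_hull (𝒟 : VacuumCauchyDevelopment D) [𝒟.metric.HasLeviCivita]
    {q : ℕ → 𝒟.carrier} {𝓢 : Spacetime.{0} 4} {p : 𝓢.carrier}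
    (Dat : Spacetime.LocalSubconvergence (fun _ ↦ 𝒟.toSpacetime) q 𝓢 p 2) {M a R : ℝ}
    {x₀ : Kerr.exterior M a} {Ψ : Kerr.exterior M a → 𝓢.carrier} {O : Set E4} {Ψ' : E4 → 𝓢.carrier}
    {ε : ℝ≥0∞} (hM : 0 ≤ M) (ha : |a| ≤ M) (hO : IsOpen O)
    (hKO : closure (Subtype.val '' kerrWindow M a x₀ R) ⊆ O) (hΨ' : ContMDiffOn 𝓘(ℝ, E4) (𝓡 4) ∞ Ψ' O)
    (hΨ : ∀ x ∈ kerrWindow M a x₀ R, Ψ x = Ψ' x.1) (hW : IsWindowChart 𝓢 M a x₀ R p Ψ)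
    (hτ : ∀ y ∈ closure (Subtype.val '' kerrWindow M a x₀ R), 2 * M ≤ Kerr.radius a y →
      𝓢.metric.IsTimelike (mfderiv 𝓘(ℝ, E4) (𝓡 4) Ψ' y (E4.basisVector 0)) ∧
        𝓢.timeOrientation.IsFutureDirected (mfderiv 𝓘(ℝ, E4) (𝓡 4) Ψ' y (E4.basisVector 0)))
    (hdev : supCkENorm (Subtype.val '' kerrWindow M a x₀ R) 2 (𝓢.deviationExtend (Kerr.background M a) Ψ) < ε) :
    ∀ᶠ n in atTop, kerrDev 𝒟.toSpacetime (q (Dat.sub n)) R < ε :=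
  stub_silentHullDictionary_extendable Dat hM ha hO hKO hΨ' hΨ hW hτ hdev

end Hull

/-! ### The flat model: the timelike margin is automatic for pinched representatives -/

section Flat

variable {𝓢ₙ : ℕ → Spacetime.{0} 4} {pₙ : ∀ n, (𝓢ₙ n).carrier} {𝓢 : Spacetime.{0} 4} {p : 𝓢.carrier}

/-- **Flat windows: only extendability is needed.** For the parameters `M = a = 0` (window = a Euclidean ball
punctured along the time axis, background `η`), if the representative `Ψ'` is `C^∞` and `C⁰`-PINCHED
(`‖Ψ'^* g − η‖ < 1`) on a preconnected open `O ⊇ closure W`, the timelike margin holds on all of `O`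
(`isTimelike_mfderiv_basisVector_zero_of_norm_metricInCoords_sub_lt_one`; one orientation on the connected `O` from
the anchor, `isFutureDirected_mfderiv_of_isPreconnected`), so the dictionary needs no orientation hypothesis:
window `C²`-deviation `< ε` forces eventually `kerrDev (𝓢ₙ (Dat.sub n)) (pₙ (Dat.sub n)) R < ε`.
[cite: ONeill1983, Ch. 5, Lemma 5.26 ff., p. 145] -/
theorem stub_silentHullDictionary_flat (Dat : Spacetime.LocalSubconvergence 𝓢ₙ pₙ 𝓢 p 2) {R : ℝ}
    {x₀ : Kerr.exterior 0 0} {Ψ : Kerr.exterior 0 0 → 𝓢.carrier} {O : Set E4} {Ψ' : E4 → 𝓢.carrier} {ε : ℝ≥0∞}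
    (hO : IsOpen O) (hOc : IsPreconnected O) (hKO : closure (Subtype.val '' kerrWindow 0 0 x₀ R) ⊆ O)
    (hΨ' : ContMDiffOn 𝓘(ℝ, E4) (𝓡 4) ∞ Ψ' O) (hpinch : ∀ y ∈ O, ‖𝓢.metricInCoords Ψ' y - Minkowski.bilin‖ < 1)
    (hΨ : ∀ x ∈ kerrWindow 0 0 x₀ R, Ψ x = Ψ' x.1) (hW : IsWindowChart 𝓢 0 0 x₀ R p Ψ)
    (hdev : supCkENorm (Subtype.val '' kerrWindow 0 0 x₀ R) 2 (𝓢.deviationExtend (Kerr.background 0 0) Ψ) < ε) :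
    ∀ᶠ n in atTop, kerrDev (𝓢ₙ (Dat.sub n)) (pₙ (Dat.sub n)) R < ε := by
  rcases le_or_gt R 0 with hR | hR
  · -- empty window: `kerrDev = 0 < ε`
    exact Eventually.of_forall fun n ↦ by
      rw [kerrDev_of_nonpos _ hR]
      exact zero_le.trans_lt hdev
  -- the anchor lies in the window, where `dΨ(∂₀) = dΨ'(∂₀)` is future-directed (`r > 0 = 2M` everywhere)
  have hx₀ : x₀ ∈ kerrWindow 0 0 x₀ R := by
    show dist x₀.1 x₀.1 < R
    rw [dist_self]
    exact hR
  have hx₀O : x₀.1 ∈ O := hKO (subset_closure ⟨x₀, hx₀, rfl⟩)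
  have htl : ∀ y ∈ O, 𝓢.metric.IsTimelike (mfderiv 𝓘(ℝ, E4) (𝓡 4) Ψ' y (E4.basisVector 0)) := fun y hy ↦
    𝓢.isTimelike_mfderiv_basisVector_zero_of_norm_metricInCoords_sub_lt_one (hpinch y hy)
  have hd₀ : MDifferentiableAt 𝓘(ℝ, E4) (𝓡 4) (id ∘ Ψ') x₀.1 :=
    ((hΨ' _ hx₀O).contMDiffAt (hO.mem_nhds hx₀O)).mdifferentiableAt (by simp)
  have hfut₀ : 𝓢.timeOrientation.IsFutureDirected (mfderiv 𝓘(ℝ, E4) (𝓡 4) Ψ' x₀.1 (E4.basisVector 0)) := by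
    have h := hW.future x₀ hx₀ (by rw [mul_zero]; exact Kerr.radius_pos_of_mem_region x₀.2)
    rw [show mfderiv 𝓘(ℝ, E4) (𝓡 4) Ψ x₀ = mfderiv 𝓘(ℝ, E4) (𝓡 4) Ψ' x₀.1 from
      mfderiv_comp_eq_of_eqOn_kerrWindow id hΨ hx₀ hd₀] at h
    exact (isFutureDirected_iff_of_eq (hΨ x₀ hx₀)).1 h
  have hfut : ∀ y ∈ O, 𝓢.timeOrientation.IsFutureDirected (mfderiv 𝓘(ℝ, E4) (𝓡 4) Ψ' y (E4.basisVector 0)) :=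
    Spacetime.isFutureDirected_mfderiv_of_isPreconnected hO hΨ' hOc subset_rfl (E4.basisVector 0)
      (fun y hy ↦ (htl y hy).isCausal) hx₀O hfut₀
  exact stub_silentHullDictionary_extendable Dat le_rfl (by rw [abs_zero]) hO hKO hΨ' hΨ hW
    (fun y hy _ ↦ ⟨htl y (hKO hy), hfut y (hKO hy)⟩) hdev

end Flat

end Summit.FinalStateConjecture.FinalStateConjecture.Theorems

end
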